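import Summits.QuantumFields.YangMills.Theorems.BalabanUVNodesN06Eq3132CoerciveFromGAKnitQ
import Summits.QuantumFields.YangMills.Theorems.BalabanUVNodesN06Eq3132CoerciveVariationalQ
import Literature.MathematicalPhysics.QuantumFieldTheory.Balaban1983to89.B9Eq3132FromStateR

/-!
# BalabanUVNodes ∕ N06 ([B9], `Dag.B9_main`) — ROW 26 AT THE KNIT PAIR, PIECE 5: ROW 26 (`B9.Stmt3132Printed`) FOR THE `ν`-READINGS OF `(Q G_D Q⋆)⁻¹ ∕ (Q G₁ Q⋆)⁻¹` AT
# PRINT's KNIT AVERAGING FROM THE SECT.-D STATE TUPLE, THE DISPLAYED SYMMETRY ∕ POSITIVITY OF `Δ_a^Q` AND A TEST FAMILY — the knit twin of n06-i ∕ n06-l's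
# `B9Eq3132FromStateR.s3132Nu_opsYSectE_of_stepS_R_of_refinesY`, letter-level (the object pins are the knit certificate's)

Track A of `YM-PLAN.md` (cell `pub-ymgap`, HUMAN RULING D-0062), node **N06** = [Balaban1985BackgroundPropagators]; piece 5 of «P-Q26-knit» (KA's displayed `s3132K`;
seat `pub-ymgap-dag-n06-l` g37, 2026-08-30).  ASSEMBLY over the carrier `bg9YR … SU(N) R₁ R₂` (KA's): the four [4]-(2.51) majorants of the coordinate models of `T = G_D`, `T₁ = G₁`,
`T − T₀`, `T₁ − T₀` from the regular Sect.-D state (`B9Eq3132FromStateR.majorants4_of_stepS_R`, letter-generic, BY NAME) feed piece 2 (`DecayUnder` ×2) and piece 4 (coercivity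
transfer ×2) at the knit pair; the base coercivity of `Q (Δ_a^Q)⁻¹ Q⋆` is piece 3 (`hcoA_of_testFamily_QR`) from the DISPLAYED `IsSymmTr ∧ PosDefTr` of `Δ x U` (KA's `hΔAK` species),
the adjointness `hadj` and a test family with (P′2)ᴷ ∕ (P′1)ᴷ (displayed — the genuine remainder of the road); n06-i's generic `stmt3132Printed_nu_of_coercive_decay_R` closes
`B9.Stmt3132Printed` for the `ν`-readings `siteKernelOfOpNu … (Ring.inverse (QGQOfQY … T U))`, `… T₁ …` — the object-level pins (`(𝔏 x).QGQinv = …`) are the certificate's.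
HONEST FRAMING: composition of landed theorems; Sect.-D state, `hΔ`, `hadj`, test family, regime bridge and numerics are HYPOTHESES of printed∕elementary species; nothing of
[B9] ∕ [4] asserted; COUNT-NEUTRAL; N06 NOT discharged; nothing continuum ∕ OS ∕ mass gap ∕ Clay.  0 `def`, 0 `sorry`.
[cite: Balaban1985BackgroundPropagators, (3.132) p.422, Thm 3.12 pp.421–423, Thm 3.11 p.416, (3.115) p.418, (3.35)–(3.36) p.396; Balaban1984PropagatorsII, (2.142) (2.147) p.248,
Prop. 2.7 (2.149) p.249, Lemma 2.1 (2.60)–(2.61) p.234; Balaban1985Averaging, (139)–(147) pp.39–40]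
-/

noncomputable section

namespace Summit.QuantumFields.YangMills.BalabanUVNodes.N06Eq3132FromStateKnitQ

open scoped Matrix.Norms.L2Operator
open Literature.MathematicalPhysics.QuantumFieldTheory.Balaban1983to89
open Literature.MathematicalPhysics.QuantumFieldTheory.Balaban1983to89.Node00
open Literature.MathematicalPhysics.QuantumFieldTheory.Balaban1983to89.B6RandomWalk (HasMajorant)
open Literature.MathematicalPhysics.QuantumFieldTheory.Balaban1983to89.B11SectG (HasMaj BlockNorm)
open Literature.MathematicalPhysics.QuantumFieldTheory.Balaban1983to89.B9Thm34Ext (toB6)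
open Literature.MathematicalPhysics.QuantumFieldTheory.Balaban1983to89.B6Ineq2142KLevelV1 (lvl β)
open Literature.MathematicalPhysics.QuantumFieldTheory.Balaban1983to89.B6GlobalChartV1 (blkV1)
open Literature.MathematicalPhysics.QuantumFieldTheory.Balaban1983to89.B6KLevelCensusIndexV1 (KIdx kGeo)
open Literature.MathematicalPhysics.QuantumFieldTheory.Balaban1983to89.B9Thm312Whole (Ops Identities GeoOK cNorm)
open Literature.MathematicalPhysics.QuantumFieldTheory.Balaban1983to89.B9Thm312WholeClasses (cNormR)
open Literature.MathematicalPhysics.QuantumFieldTheory.Balaban1983to89.B9Thm312WholeStepRegular (StepS)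
open Literature.MathematicalPhysics.QuantumFieldTheory.Balaban1983to89.B9PinMembersKLevelV1 (MemberY geo9Y)
open Literature.MathematicalPhysics.QuantumFieldTheory.Balaban1983to89.B9BackgroundsKLevelV1R (RegFamY bg9YR)
open Literature.MathematicalPhysics.QuantumFieldTheory.Balaban1983to89.B7Prop2SpecialUnitary (specialUnitaryUnits specialUnitaryUnits_le_unitaryUnits)
open Literature.MathematicalPhysics.QuantumFieldTheory.Balaban1983to89.B9CoReadingCoords (XBK blkBK GcoK)
open Literature.MathematicalPhysics.QuantumFieldTheory.Balaban1983to89.B9CoReadingCoordsTranspose (TrIdx trBasis)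
open Literature.MathematicalPhysics.QuantumFieldTheory.Balaban1983to89.B9Thm311ReadingCoords (trIP PosDefTr IsSymmTr IsAdjTr)
open Literature.MathematicalPhysics.QuantumFieldTheory.Balaban1983to89.B9RWSumsReadsNbr (nbr)
open Literature.MathematicalPhysics.QuantumFieldTheory.Balaban1983to89.B9Eq3132RingInverseReading (normMatY)
open Literature.MathematicalPhysics.QuantumFieldTheory.Balaban1983to89.B9Eq3132NuReading (lamInvY nuY siteKernelOfOpNu)
open Literature.MathematicalPhysics.QuantumFieldTheory.Balaban1983to89.B9Eq3132NuReadingR (stmt3132Printed_nu_of_coercive_decay_R)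
open Literature.MathematicalPhysics.QuantumFieldTheory.Balaban1983to89.B9Eq3132CTInputs (CoerciveUnder DecayUnder)
open Literature.MathematicalPhysics.QuantumFieldTheory.Balaban1983to89.B9Eq3132ScalarIndex (geoComap)
open Literature.MathematicalPhysics.QuantumFieldTheory.Balaban1983to89.B9Eq3132FromStateR (majorants4_of_stepS_R)
open Literature.MathematicalPhysics.QuantumFieldTheory.Balaban1983to89.Node00.OpsYQLetter (QLetterY QsLetterY adjTrY)
open Literature.MathematicalPhysics.QuantumFieldTheory.Balaban1983to89.B9Eq316AveragingTransposeZd (alphaQ)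
open Literature.MathematicalPhysics.QuantumFieldTheory.Balaban1983to89.B9Eq3115KnitLetterY (QknitY)
open Literature.MathematicalPhysics.QuantumFieldTheory.Balaban1983to89.B9C2FormBoxRegimeY (Kpl)
open Literature.MathematicalPhysics.QuantumFieldTheory.Balaban1983to89.B9BackgroundsKLevelV1P (bg9KP)
open Summit.QuantumFields.YangMills.BalabanUVNodes.N06Eq3132DecayFromMajorantKnitQ (decayUnder_QGQOfQY_knit_of_majorants_R)
open Summit.QuantumFields.YangMills.BalabanUVNodes.N06Eq3132CoerciveFromGAKnitQ (coerciveUnder_of_subMajorants_knit_R)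
open Summit.QuantumFields.YangMills.BalabanUVNodes.N06Eq3132CoerciveVariationalQ (hcoA_of_testFamily_QR)

section Faces

variable {κ : Type} [Fintype κ] [DecidableEq κ] {N : ℕ} [Nonempty (Fin N)]
variable (θ : Stage3Params) (Mstar : ℕ) (R₁ R₂ : RegFamY θ.d₆ θ.ℓ₆ θ.hd' θ.hL' θ.b₀ θ.b₁ Mstar (Matrix (Fin N) (Fin N) ℂ))
  [∀ x : MemberY θ.d₆ θ.ℓ₆ θ.hd' θ.hL' θ.b₀ θ.b₁ Mstar, Fintype (geo9Y x).Site] [∀ x : MemberY θ.d₆ θ.ℓ₆ θ.hd' θ.hL' θ.b₀ θ.b₁ Mstar, DecidableEq (geo9Y x).Site]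
  {Y Z W : MemberY θ.d₆ θ.ℓ₆ θ.hd' θ.hL' θ.b₀ θ.b₁ Mstar → Type} [∀ x, Fintype (Z x)] [∀ x, Fintype (W x)]
  (bK : Module.Basis κ ℝ (Matrix (Fin N) (Fin N) ℂ)) {c35 : ℝ}
  (𝔬 : ∀ x : MemberY θ.d₆ θ.ℓ₆ θ.hd' θ.hL' θ.b₀ θ.b₁ Mstar, Ops (geo9Y x) (bg9YR (Matrix (Fin N) (Fin N) ℂ) (specialUnitaryUnits (Fin N)) R₁ R₂ x) (XBK κ x.toKIdx) (Y x) (Z x) (W x))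
  (H₀ : MemberY θ.d₆ θ.ℓ₆ θ.hd' θ.hL' θ.b₀ θ.b₁ Mstar → Prop)
  -- the Sect.-D propagator letters `T = G_D(U)`, `T₁ = G₁(U)` (ANY) and `T₀ = G_A^Q(U) = (Δ_a^Q(U))⁻¹`
  (T T₁ T₀ : ∀ x : MemberY θ.d₆ θ.ℓ₆ θ.hd' θ.hL' θ.b₀ θ.b₁ Mstar, BondOpY (Matrix (Fin N) (Fin N) ℂ) x.toKIdx)
  (Δ : ∀ x : MemberY θ.d₆ θ.ℓ₆ θ.hd' θ.hL' θ.b₀ θ.b₁ Mstar, CfgY (Matrix (Fin N) (Fin N) ℂ) x.toKIdx →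
    ((FBondY x.toKIdx → Matrix (Fin N) (Fin N) ℂ) →ₗ[ℂ] (FBondY x.toKIdx → Matrix (Fin N) (Fin N) ℂ)))
  (hT₀ : ∀ (x : MemberY θ.d₆ θ.ℓ₆ θ.hd' θ.hL' θ.b₀ θ.b₁ Mstar) (U : CfgY (Matrix (Fin N) (Fin N) ℂ) x.toKIdx), T₀ x U = Ring.inverse (Δ x U))
  -- print's knit averaging pair (pinned by `rfl` at def-Y's `qKnitOfRecord ∕ qsKnitOfRecord`)
  (𝔮 : ∀ x : MemberY θ.d₆ θ.ℓ₆ θ.hd' θ.hL' θ.b₀ θ.b₁ Mstar, QLetterY (Matrix (Fin N) (Fin N) ℂ) x.toKIdx)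
  (𝔮s : ∀ x : MemberY θ.d₆ θ.ℓ₆ θ.hd' θ.hL' θ.b₀ θ.b₁ Mstar, QsLetterY (Matrix (Fin N) (Fin N) ℂ) x.toKIdx)
  (h𝔮 : ∀ (x : MemberY θ.d₆ θ.ℓ₆ θ.hd' θ.hL' θ.b₀ θ.b₁ Mstar) (U : CfgY (Matrix (Fin N) (Fin N) ℂ) x.toKIdx), 𝔮 x U = QknitY x.toKIdx U)
  (h𝔮s : ∀ (x : MemberY θ.d₆ θ.ℓ₆ θ.hd' θ.hL' θ.b₀ θ.b₁ Mstar) (U : CfgY (Matrix (Fin N) (Fin N) ℂ) x.toKIdx), 𝔮s x U = adjTrY (QknitY x.toKIdx U))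
  (hadj : ∀ (x : MemberY θ.d₆ θ.ℓ₆ θ.hd' θ.hL' θ.b₀ θ.b₁ Mstar) (α₀ : ℝ) (U : (bg9YR (Matrix (Fin N) (Fin N) ℂ) (specialUnitaryUnits (Fin N)) R₁ R₂ x).Cfg),
    (bg9YR (Matrix (Fin N) (Fin N) ℂ) (specialUnitaryUnits (Fin N)) R₁ R₂ x).Reg335 c35 α₀ U → IsAdjTr (fun _ => (1 : ℝ)) (fun _ => (1 : ℝ)) (𝔮 x U) (𝔮s x U))
  -- the regime bridge to the member's local class and the x-free knit numerics
  {c₀ : ℝ} (hc : c₀ ≤ 10)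
  (hRP : ∀ (x : MemberY θ.d₆ θ.ℓ₆ θ.hd' θ.hL' θ.b₀ θ.b₁ Mstar) (α₀ : ℝ) (U : (bg9YR (Matrix (Fin N) (Fin N) ℂ) (specialUnitaryUnits (Fin N)) R₁ R₂ x).Cfg),
    (bg9YR (Matrix (Fin N) (Fin N) ℂ) (specialUnitaryUnits (Fin N)) R₁ R₂ x).Reg335 c35 α₀ U →
      (bg9KP (Matrix (Fin N) (Fin N) ℂ) (specialUnitaryUnits (Fin N)) x.toKIdx).Reg335 c₀ α₀ U)
  {α₀' : ℝ} (hα' : 0 < α₀') (hαQ : α₀' ≤ alphaQ (θ.d₆ + 1) (θ.ℓ₆ + 1)) {aK : ℝ} (haK : 0 < aK)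
  (hKpl : ∀ (x : MemberY θ.d₆ θ.ℓ₆ θ.hd' θ.hL' θ.b₀ θ.b₁ Mstar) (a : ℝ), 0 ≤ a → a ≤ aK → Kpl x.toKIdx a * (kGeo x.toKIdx).L ^ 4 < α₀')
  -- the coordinate pins of the walk record and the block geometry
  {bI : ∀ x : MemberY θ.d₆ θ.ℓ₆ θ.hd' θ.hL' θ.b₀ θ.b₁ Mstar, FBondY x.toKIdx → IBondY x.toKIdx} (hblk : ∀ x, (𝔬 x).blk = blkBK x.toKIdx (bI x))
  (hGco : ∀ (x : MemberY θ.d₆ θ.ℓ₆ θ.hd' θ.hL' θ.b₀ θ.b₁ Mstar) (U : (bg9YR (Matrix (Fin N) (Fin N) ℂ) (specialUnitaryUnits (Fin N)) R₁ R₂ x).Cfg), (𝔬 x).G U = GcoK x.toKIdx bK (bg9YR (Matrix (Fin N) (Fin N) ℂ) (specialUnitaryUnits (Fin N)) R₁ R₂ x) (fun U => U) (T x) U)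
  (hG1co : ∀ (x : MemberY θ.d₆ θ.ℓ₆ θ.hd' θ.hL' θ.b₀ θ.b₁ Mstar) (U : (bg9YR (Matrix (Fin N) (Fin N) ℂ) (specialUnitaryUnits (Fin N)) R₁ R₂ x).Cfg), (𝔬 x).G1 U = GcoK x.toKIdx bK (bg9YR (Matrix (Fin N) (Fin N) ℂ) (specialUnitaryUnits (Fin N)) R₁ R₂ x) (fun U => U) (T₁ x) U)
  (hG0co : ∀ (x : MemberY θ.d₆ θ.ℓ₆ θ.hd' θ.hL' θ.b₀ θ.b₁ Mstar) (U : (bg9YR (Matrix (Fin N) (Fin N) ℂ) (specialUnitaryUnits (Fin N)) R₁ R₂ x).Cfg), (𝔬 x).G0 U = GcoK x.toKIdx bK (bg9YR (Matrix (Fin N) (Fin N) ℂ) (specialUnitaryUnits (Fin N)) R₁ R₂ x) (fun U => U) (T₀ x) U)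
  (hlev : ∀ (x : MemberY θ.d₆ θ.ℓ₆ θ.hd' θ.hL' θ.b₀ θ.b₁ Mstar) (f : FBondY x.toKIdx), lvl x.hN x.D x.hk (bI x f) = (blkV1 x.hN x.D f).1.1)
  (hβ1 : ∀ (x : MemberY θ.d₆ θ.ℓ₆ θ.hd' θ.hL' θ.b₀ θ.b₁ Mstar) (f : FBondY x.toKIdx), (B6Geom246MultiLevelTorus.geomT x.D).dist (β x.hN x.D x.hk (bI x f)) (blkV1 x.hN x.D f) ≤ 1)
  {mN : ℕ} (hnbr : ∀ (x : MemberY θ.d₆ θ.ℓ₆ θ.hd' θ.hL' θ.b₀ θ.b₁ Mstar) (y : (geo9Y x).Site), (nbr (geo9Y x) ((θ.ℓ₆ : ℝ) + 4) y).card ≤ mN)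
  (𝔖 : ∀ x : MemberY θ.d₆ θ.ℓ₆ θ.hd' θ.hL' θ.b₀ θ.b₁ Mstar, (bg9YR (Matrix (Fin N) (Fin N) ℂ) (specialUnitaryUnits (Fin N)) R₁ R₂ x).Cfg → BlockNorm (toB6 (geo9Y x) 1 (H₀ x)) (XBK κ x.toKIdx → ℝ))
  (θS A₀ CR κS δK δP σ δ a₁ M₁ : ℝ) (hθS : 0 ≤ θS) (hA₀ : 0 ≤ A₀) (hCR : 0 ≤ CR) (hκS : 0 ≤ κS) (hσ : 0 < σ) (hδ : 0 < δ) (hδK : δ + 2 * σ ≤ δK) (hδP : δ + σ ≤ δP)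
  (ha₁ : 0 < a₁) (hM₁ : 0 < M₁) (hgeo : ∀ x : MemberY θ.d₆ θ.ℓ₆ θ.hd' θ.hL' θ.b₀ θ.b₁ Mstar, GeoOK (geo9Y x))
  -- ROW 17 at the knit pair, DISPLAYED (KA's `hΔAK` species): symmetry AND positivity of `Δ x U`
  (a311 M311 : ℝ) (ha311 : 0 < a311) (hM311 : 0 < M311)
  (hΔ : ∀ x : MemberY θ.d₆ θ.ℓ₆ θ.hd' θ.hL' θ.b₀ θ.b₁ Mstar, M311 ≤ (geo9Y x).M → ∀ α₀ : ℝ, 0 < α₀ → (geo9Y x).M * α₀ ≤ a311 →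
    ∀ U : (bg9YR (Matrix (Fin N) (Fin N) ℂ) (specialUnitaryUnits (Fin N)) R₁ R₂ x).Cfg,
      (bg9YR (Matrix (Fin N) (Fin N) ℂ) (specialUnitaryUnits (Fin N)) R₁ R₂ x).Reg335 c35 α₀ U → IsSymmTr (fun _ => (1 : ℝ)) (Δ x U) ∧ PosDefTr (fun _ => (1 : ℝ)) (Δ x U))
  -- the knit test family with (P′2)ᴷ ∕ (P′1)ᴷ, DISPLAYED (the genuine remainder of the road)
  (Tt : ∀ x : MemberY θ.d₆ θ.ℓ₆ θ.hd' θ.hL' θ.b₀ θ.b₁ Mstar, CfgY (Matrix (Fin N) (Fin N) ℂ) x.toKIdx →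
    (IBondY x.toKIdx → Matrix (Fin N) (Fin N) ℂ) → (FBondY x.toKIdx → Matrix (Fin N) (Fin N) ℂ))
  (hTt : ∃ Mt aT ϑ C : ℝ, 0 < Mt ∧ 0 < aT ∧ ϑ < 1 ∧ 0 < C ∧
    ∀ x : MemberY θ.d₆ θ.ℓ₆ θ.hd' θ.hL' θ.b₀ θ.b₁ Mstar, Mt ≤ (geo9Y x).M → ∀ α₀ : ℝ, 0 < α₀ → (geo9Y x).M * α₀ ≤ aT →
      ∀ U : (bg9YR (Matrix (Fin N) (Fin N) ℂ) (specialUnitaryUnits (Fin N)) R₁ R₂ x).Cfg,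
        (bg9YR (Matrix (Fin N) (Fin N) ℂ) (specialUnitaryUnits (Fin N)) R₁ R₂ x).Reg335 c35 α₀ U →
        (bg9YR (Matrix (Fin N) (Fin N) ℂ) (specialUnitaryUnits (Fin N)) R₁ R₂ x).Reg336 c35 α₀ U →
          (∀ Ψ : IBondY x.toKIdx → Matrix (Fin N) (Fin N) ℂ,
            (1 - ϑ) * trIP (fun _ => (1 : ℝ)) Ψ Ψ ≤ trIP (fun _ => (1 : ℝ)) (𝔮 x U (Tt x U Ψ)) (fun y => lamInvY x.toKIdx y • Ψ y)) ∧
          (∀ Ψ : IBondY x.toKIdx → Matrix (Fin N) (Fin N) ℂ,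
            trIP (fun _ => (1 : ℝ)) (Tt x U Ψ) (Δ x U (Tt x U Ψ)) ≤ C * trIP (fun _ => (1 : ℝ)) Ψ Ψ))

include hblk hGco hG1co hG0co hθS hA₀ hCR hκS hσ hδ hδK hδP ha₁ hM₁ hlev hβ1 hnbr h𝔮 h𝔮s hc hRP hα' hαQ haK hKpl in
/-- ★ **ROW 26's TWO DECAY BINDERS AT THE KNIT PAIR FROM THE STATE TUPLE** (`majorants4_of_stepS_R` + piece 2 twice).
[cite: Balaban1985BackgroundPropagators, (3.132) p.422, Thm 3.12 pp.421–423, (3.115) p.418, (3.35)–(3.36) p.396; Balaban1984PropagatorsII, (2.142) p.248, (2.51) p.232, Lemma 2.1 (2.60)–(2.61) p.234] -/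
theorem hdec26_of_stepS_knit_R
    (hstate : ∀ x : MemberY θ.d₆ θ.ℓ₆ θ.hd' θ.hL' θ.b₀ θ.b₁ Mstar, M₁ ≤ (geo9Y x).M → ∀ α₀ : ℝ, 0 < α₀ → (geo9Y x).M * α₀ ≤ a₁ →
    ∀ U : (bg9YR (Matrix (Fin N) (Fin N) ℂ) (specialUnitaryUnits (Fin N)) R₁ R₂ x).Cfg,
      (bg9YR (Matrix (Fin N) (Fin N) ℂ) (specialUnitaryUnits (Fin N)) R₁ R₂ x).Reg335 c35 α₀ U → (bg9YR (Matrix (Fin N) (Fin N) ℂ) (specialUnitaryUnits (Fin N)) R₁ R₂ x).Reg336 c35 α₀ U →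
        StepS (𝔬 x) (𝔖 x U) (θS * ((geo9Y x).M * α₀)) δK U ∧
        HasMaj (cNorm 1 (H₀ x) (𝔬 x).blk (hgeo x).lenle 0) (𝔖 x U) ((𝔬 x).G0 U) (fun a b => A₀ * Real.exp (-(δP * (geo9Y x).dist a b))) ∧
        HasMaj (𝔖 x U) (cNormR 1 (H₀ x) (𝔬 x).blk (hgeo x).lenle (-2)) LinearMap.id (fun a b => CR * Real.exp (-(δP * (geo9Y x).dist a b))) ∧
        (𝔖 x U).κ ≤ κS ∧ (∃ Λ : ℝ, 0 ≤ Λ ∧ ∀ (y : (geo9Y x).Site) (F : XBK κ x.toKIdx → ℝ), (𝔖 x U).loc y F ≤ Λ * ∑ q : XBK κ x.toKIdx, |F q|) ∧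
        Identities (𝔬 x) U) :
    DecayUnder c35 (fun x : MemberY θ.d₆ θ.ℓ₆ θ.hd' θ.hL' θ.b₀ θ.b₁ Mstar => geoComap (geo9Y x) (Prod.fst : (geo9Y x).Site × TrIdx N → (geo9Y x).Site))
        (bg9YR (Matrix (Fin N) (Fin N) ℂ) (specialUnitaryUnits (Fin N)) R₁ R₂)
        (fun x U => normMatY (trBasis N) (lamInvY x.toKIdx) (QGQOfQY x.toKIdx (𝔮 x) (𝔮s x) (T x) U)) ∧
      DecayUnder c35 (fun x : MemberY θ.d₆ θ.ℓ₆ θ.hd' θ.hL' θ.b₀ θ.b₁ Mstar => geoComap (geo9Y x) (Prod.fst : (geo9Y x).Site × TrIdx N → (geo9Y x).Site))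
        (bg9YR (Matrix (Fin N) (Fin N) ℂ) (specialUnitaryUnits (Fin N)) R₁ R₂)
        (fun x U => normMatY (trBasis N) (lamInvY x.toKIdx) (QGQOfQY x.toKIdx (𝔮 x) (𝔮s x) (T₁ x) U)) := by
  obtain ⟨M₂, a₂, C₁, C₂, hM₂, ha₂, hC₁, -, hmaj⟩ := majorants4_of_stepS_R R₁ R₂ (G := specialUnitaryUnits (Fin N)) bK 𝔬 H₀ T T₁ T₀ hblk hGco hG1co hG0co 𝔖
    θS A₀ CR κS δK δP σ δ a₁ M₁ hθS hA₀ hCR hκS hσ hδ hδK hδP ha₁ hM₁ hgeo hstate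
  exact ⟨decayUnder_QGQOfQY_knit_of_majorants_R R₁ R₂ specialUnitaryUnits_le_unitaryUnits bK (trBasis N) T 𝔮 𝔮s h𝔮 h𝔮s hc hRP hα' hαQ haK hKpl hlev hβ1 hnbr
      (R := fun _ => 1) ⟨M₂, a₂, C₁, δ, hM₂, ha₂, hC₁, hδ, fun x hM α₀ hα₀ hMa U hU hU' => (hmaj x hM α₀ hα₀ hMa U hU hU').1⟩,
    decayUnder_QGQOfQY_knit_of_majorants_R R₁ R₂ specialUnitaryUnits_le_unitaryUnits bK (trBasis N) T₁ 𝔮 𝔮s h𝔮 h𝔮s hc hRP hα' hαQ haK hKpl hlev hβ1 hnbr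
      (R := fun _ => 1) ⟨M₂, a₂, C₁, δ, hM₂, ha₂, hC₁, hδ, fun x hM α₀ hα₀ hMa U hU hU' => (hmaj x hM α₀ hα₀ hMa U hU hU').2.1⟩⟩

include hblk hGco hG1co hG0co hθS hA₀ hCR hκS hσ hδ hδK hδP ha₁ hM₁ hlev hβ1 hnbr h𝔮 h𝔮s hc hRP hα' hαQ haK hKpl hT₀ hadj ha311 hM311 hΔ hTt in
/-- ★★ **ROW 26's TWO COERCIVITY BINDERS AT THE KNIT PAIR FROM ROW 17 (displayed at `Δ_a^Q`), A TEST FAMILY AND THE STATE TUPLE** (piece 3 + `majorants4_of_stepS_R` + piece 4 twice).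
[cite: Balaban1985BackgroundPropagators, (3.132) p.422, Thm 3.12 pp.421–423, Thm 3.11 p.416, (3.115) p.418, (3.35)–(3.36) p.396; Balaban1984PropagatorsII, (2.147) p.248] -/
theorem hco26_of_stepS_knit_R
    (hstate : ∀ x : MemberY θ.d₆ θ.ℓ₆ θ.hd' θ.hL' θ.b₀ θ.b₁ Mstar, M₁ ≤ (geo9Y x).M → ∀ α₀ : ℝ, 0 < α₀ → (geo9Y x).M * α₀ ≤ a₁ →
    ∀ U : (bg9YR (Matrix (Fin N) (Fin N) ℂ) (specialUnitaryUnits (Fin N)) R₁ R₂ x).Cfg,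
      (bg9YR (Matrix (Fin N) (Fin N) ℂ) (specialUnitaryUnits (Fin N)) R₁ R₂ x).Reg335 c35 α₀ U → (bg9YR (Matrix (Fin N) (Fin N) ℂ) (specialUnitaryUnits (Fin N)) R₁ R₂ x).Reg336 c35 α₀ U →
        StepS (𝔬 x) (𝔖 x U) (θS * ((geo9Y x).M * α₀)) δK U ∧
        HasMaj (cNorm 1 (H₀ x) (𝔬 x).blk (hgeo x).lenle 0) (𝔖 x U) ((𝔬 x).G0 U) (fun a b => A₀ * Real.exp (-(δP * (geo9Y x).dist a b))) ∧
        HasMaj (𝔖 x U) (cNormR 1 (H₀ x) (𝔬 x).blk (hgeo x).lenle (-2)) LinearMap.id (fun a b => CR * Real.exp (-(δP * (geo9Y x).dist a b))) ∧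
        (𝔖 x U).κ ≤ κS ∧ (∃ Λ : ℝ, 0 ≤ Λ ∧ ∀ (y : (geo9Y x).Site) (F : XBK κ x.toKIdx → ℝ), (𝔖 x U).loc y F ≤ Λ * ∑ q : XBK κ x.toKIdx, |F q|) ∧
        Identities (𝔬 x) U) :
    CoerciveUnder c35 (fun x : MemberY θ.d₆ θ.ℓ₆ θ.hd' θ.hL' θ.b₀ θ.b₁ Mstar => geoComap (geo9Y x) (Prod.fst : (geo9Y x).Site × TrIdx N → (geo9Y x).Site))
        (bg9YR (Matrix (Fin N) (Fin N) ℂ) (specialUnitaryUnits (Fin N)) R₁ R₂)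
        (fun x U => normMatY (trBasis N) (lamInvY x.toKIdx) (QGQOfQY x.toKIdx (𝔮 x) (𝔮s x) (T x) U)) ∧
      CoerciveUnder c35 (fun x : MemberY θ.d₆ θ.ℓ₆ θ.hd' θ.hL' θ.b₀ θ.b₁ Mstar => geoComap (geo9Y x) (Prod.fst : (geo9Y x).Site × TrIdx N → (geo9Y x).Site))
        (bg9YR (Matrix (Fin N) (Fin N) ℂ) (specialUnitaryUnits (Fin N)) R₁ R₂)
        (fun x U => normMatY (trBasis N) (lamInvY x.toKIdx) (QGQOfQY x.toKIdx (𝔮 x) (𝔮s x) (T₁ x) U)) := by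
  have hcoA := hcoA_of_testFamily_QR Mstar R₁ R₂ (G := specialUnitaryUnits (Fin N)) 𝔮 𝔮s Δ T₀ hT₀ hadj a311 M311 ha311 hM311 hΔ Tt hTt
  obtain ⟨M₂, a₂, C₁, C₂, hM₂, ha₂, -, hC₂, hmaj⟩ := majorants4_of_stepS_R R₁ R₂ (G := specialUnitaryUnits (Fin N)) bK 𝔬 H₀ T T₁ T₀ hblk hGco hG1co hG0co 𝔖
    θS A₀ CR κS δK δP σ δ a₁ M₁ hθS hA₀ hCR hκS hσ hδ hδK hδP ha₁ hM₁ hgeo hstate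
  exact ⟨coerciveUnder_of_subMajorants_knit_R R₁ R₂ specialUnitaryUnits_le_unitaryUnits bK (trBasis N) T T₀ 𝔮 𝔮s h𝔮 h𝔮s hc hRP hα' hαQ haK hKpl hlev hβ1 hnbr
      (R := fun _ => 1) hcoA ⟨M₂, a₂, C₂, δ, hM₂, ha₂, hC₂, hδ, fun x hM α₀ hα₀ hMa U hU hU' => (hmaj x hM α₀ hα₀ hMa U hU hU').2.2.1⟩,
    coerciveUnder_of_subMajorants_knit_R R₁ R₂ specialUnitaryUnits_le_unitaryUnits bK (trBasis N) T₁ T₀ 𝔮 𝔮s h𝔮 h𝔮s hc hRP hα' hαQ haK hKpl hlev hβ1 hnbr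
      (R := fun _ => 1) hcoA ⟨M₂, a₂, C₂, δ, hM₂, ha₂, hC₂, hδ, fun x hM α₀ hα₀ hMa U hU hU' => (hmaj x hM α₀ hα₀ hMa U hU hU').2.2.2⟩⟩

include hblk hGco hG1co hG0co hθS hA₀ hCR hκS hσ hδ hδK hδP ha₁ hM₁ hlev hβ1 hnbr h𝔮 h𝔮s hc hRP hα' hαQ haK hKpl hT₀ hadj ha311 hM311 hΔ hTt in
/-- ★★★ **ROW 26 AT THE KNIT PAIR FROM THE STATE TUPLE, ROW 17 (at `Δ_a^Q`) AND A TEST FAMILY, FOR THE `ν`-READINGS OF THE TWO RING INVERSES** `(Q G_D Q⋆)⁻¹ = Ring.inverse (𝔮 T 𝔮⋆)`,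
`(Q G₁ Q⋆)⁻¹ = Ring.inverse (𝔮 T₁ 𝔮⋆)`: `B9.Stmt3132Printed (d+1) c35 geo9Y (bg9YR … R₁ R₂)` — the object-level reading (`siteKernelR R₁ R₂ (INST x).QGQinv = …`) is the certificate's pin.
[cite: Balaban1985BackgroundPropagators, (3.132) p.422, Thm 3.12 pp.421–423, Thm 3.11 p.416, (3.115) p.418, (3.35)–(3.36) p.396; Balaban1984PropagatorsII, (2.142) (2.147) p.248, Prop. 2.7 (2.149) p.249] -/
theorem s3132_nu_knit_of_stepS_R
    (hstate : ∀ x : MemberY θ.d₆ θ.ℓ₆ θ.hd' θ.hL' θ.b₀ θ.b₁ Mstar, M₁ ≤ (geo9Y x).M → ∀ α₀ : ℝ, 0 < α₀ → (geo9Y x).M * α₀ ≤ a₁ →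
    ∀ U : (bg9YR (Matrix (Fin N) (Fin N) ℂ) (specialUnitaryUnits (Fin N)) R₁ R₂ x).Cfg,
      (bg9YR (Matrix (Fin N) (Fin N) ℂ) (specialUnitaryUnits (Fin N)) R₁ R₂ x).Reg335 c35 α₀ U → (bg9YR (Matrix (Fin N) (Fin N) ℂ) (specialUnitaryUnits (Fin N)) R₁ R₂ x).Reg336 c35 α₀ U →
        StepS (𝔬 x) (𝔖 x U) (θS * ((geo9Y x).M * α₀)) δK U ∧
        HasMaj (cNorm 1 (H₀ x) (𝔬 x).blk (hgeo x).lenle 0) (𝔖 x U) ((𝔬 x).G0 U) (fun a b => A₀ * Real.exp (-(δP * (geo9Y x).dist a b))) ∧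
        HasMaj (𝔖 x U) (cNormR 1 (H₀ x) (𝔬 x).blk (hgeo x).lenle (-2)) LinearMap.id (fun a b => CR * Real.exp (-(δP * (geo9Y x).dist a b))) ∧
        (𝔖 x U).κ ≤ κS ∧ (∃ Λ : ℝ, 0 ≤ Λ ∧ ∀ (y : (geo9Y x).Site) (F : XBK κ x.toKIdx → ℝ), (𝔖 x U).loc y F ≤ Λ * ∑ q : XBK κ x.toKIdx, |F q|) ∧
        Identities (𝔬 x) U) :
    B9.Stmt3132Printed (θ.d₆ + 1) c35 (geo9Y (d := θ.d₆) (ℓ := θ.ℓ₆) (hd := θ.hd') (hL := θ.hL') (b₀ := θ.b₀) (b₁ := θ.b₁) (Mstar := Mstar))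
      (bg9YR (Matrix (Fin N) (Fin N) ℂ) (specialUnitaryUnits (Fin N)) R₁ R₂)
      (fun x => siteKernelOfOpNu x.toKIdx (bg9YR (Matrix (Fin N) (Fin N) ℂ) (specialUnitaryUnits (Fin N)) R₁ R₂ x) (fun U => U) (nuY (θ.d₆ + 1) x.toKIdx)
        (fun U => Ring.inverse (QGQOfQY x.toKIdx (𝔮 x) (𝔮s x) (T x) U)))
      (fun x => siteKernelOfOpNu x.toKIdx (bg9YR (Matrix (Fin N) (Fin N) ℂ) (specialUnitaryUnits (Fin N)) R₁ R₂ x) (fun U => U) (nuY (θ.d₆ + 1) x.toKIdx)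
        (fun U => Ring.inverse (QGQOfQY x.toKIdx (𝔮 x) (𝔮s x) (T₁ x) U))) := by
  obtain ⟨hdec, hdec₁⟩ := hdec26_of_stepS_knit_R θ Mstar R₁ R₂ bK 𝔬 H₀ T T₁ T₀ 𝔮 𝔮s h𝔮 h𝔮s hc hRP hα' hαQ haK hKpl hblk hGco hG1co hG0co hlev hβ1 hnbr 𝔖
    θS A₀ CR κS δK δP σ δ a₁ M₁ hθS hA₀ hCR hκS hσ hδ hδK hδP ha₁ hM₁ hgeo hstate
  obtain ⟨hco, hco₁⟩ := hco26_of_stepS_knit_R θ Mstar R₁ R₂ bK 𝔬 H₀ T T₁ T₀ Δ hT₀ 𝔮 𝔮s h𝔮 h𝔮s hadj hc hRP hα' hαQ haK hKpl hblk hGco hG1co hG0co hlev hβ1 hnbr 𝔖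
    θS A₀ CR κS δK δP σ δ a₁ M₁ hθS hA₀ hCR hκS hσ hδ hδK hδP ha₁ hM₁ hgeo a311 M311 ha311 hM311 hΔ Tt hTt hstate
  exact stmt3132Printed_nu_of_coercive_decay_R (specialUnitaryUnits (Fin N)) R₁ R₂ (trBasis N) (θ.d₆ + 1)
    (fun x U => QGQOfQY x.toKIdx (𝔮 x) (𝔮s x) (T x) U) (fun x U => QGQOfQY x.toKIdx (𝔮 x) (𝔮s x) (T₁ x) U) hco hdec hco₁ hdec₁

end Faces

end Summit.QuantumFields.YangMills.BalabanUVNodes.N06Eq3132FromStateKnitQ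

end
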